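import Literature.AlgebraicGeometry.AbelianSchemes.SerreTensorIdealTranslationKernel
import Literature.AlgebraicGeometry.AbelianSchemes.SerreTensorHomModule
import Mathlib.Algebra.Module.Torsion.Basic
import HarnessLib

/-!
# Torsion points of a Serre tensor: `(A ⊗_𝒪 𝔟)[𝔞](T) ≅ A[𝔞](T) ⊗_𝒪 𝔟` (in particular `(A ⊗_𝒪 𝔟)[N] = A[N] ⊗_𝒪 𝔟`)

Topic `AlgebraicGeometry/AbelianSchemes`, namespace `Literature.AlgebraicGeometry.AbelianSchemes.AbelianSchemeOver` (constructions with bodies + proved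
theorems; no named fact, no `sorry`, no `instance`, no notation; ANY base scheme `S`, any commutative `𝒪`).  Cell `hodgecm-mathlib`, F0/P6 «MOD», organ
**(C) «TORSION ∕ TATE»** of the Serre-tensor family (desk F0P6a-plan (g0) CENSUS-P6a §(i) `stub_ZQ` (a): «compatible with … Tate modules»; F0P6c-plan
15:15:39Z: «(C) = GEN's»; the LEVEL half of ST-2b∕ST-4): over ★ FILE 10 `SerreTensorPoints` (p845057), ★ `SerreTensorIdealTranslationKernel` (`eq_one_iff_serreHomEquiv`), ★ `SerreTensorHomModule`
(`coe_smulVecLin_subtype`) and ★ `Algebra/Module/IdempotentMatrixFixedTensor`;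
`--supports stmt-HodgeConjecture-24832`, count-neutral.  HC_CM is proved only modulo the 2 remaining named inputs (hLiu418, h413) until rung 0 closes;
this file discharges none of them.

## Mathematics

`(A ⊗_𝒪 𝔟)(T) = {v ∈ A(T)ⁿ : E·v = v} ≅ A(T) ⊗_𝒪 𝔟` (★ `serreHomEquiv`, `serrePtsEquiv`, `serrePtsTensorEquiv`), and the `𝒪`-action on `A ⊗ 𝔟` is
coordinatewise (★ `serreAction_i_comp_ι`, `matrixEnd_scalar_powProj`).  Hence for any set of scalars `𝔞 ⊆ 𝒪` a point `t` of `A ⊗ 𝔟` is killed by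
`ι(𝔞)` iff all its coordinates are (§1), and the `𝔞`-torsion submodule is

  **`(A ⊗_𝒪 𝔟)(T)[𝔞] ≃ₗ[𝒪] {v ∈ A(T)[𝔞]ⁿ : E·v = v} ≃ₗ[𝒪] A(T)[𝔞] ⊗_𝒪 𝔟`** (§2)

— `𝔟 = E·𝒪ⁿ` is projective, so `⊗ 𝔟` is exact and commutes with torsion.  With `𝔞 = {N}` (`ι(N) = [N]`, ★ `RingAction.i_natCast`) this is
`(A ⊗ 𝔟)[N](T) = A[N](T) ⊗_𝒪 𝔟` for every `T`, i.e. `T_ℓ(A ⊗ 𝔟) = T_ℓ(A) ⊗_𝒪 𝔟` level by level ([Conrad2004GrossZagier] §7 Thm. 7.5: `M ⊗_A (·)` is exact on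
finite locally free `A`-module schemes; [MilneCM2006] §7 (𝔞-multiplications and Tate modules)); with `𝔞 = 𝔴` it gives the `𝔴`-torsion blocks of
`A ⊗ 𝔟`.

## Contents

* §1 `serreHomEquiv_comp_serreAction_i` (coordinates of `t ≫ ι_{A⊗𝔟}(a)` are `t_k ≫ ι(a)`), **`comp_serreAction_i_eq_one_iff`**,
  `forall_comp_serreAction_i_eq_one_iff`, **`pow_eq_one_iff_coords`** (`t^N = 1 ↔ ∀ k, t_k^N = 1`).
* §2 `mem_torsionBySet_iff_coords`, **`serrePtsTorsionEquiv`** (`torsionBySet O ((serreAction act E hE).Pts T) 𝔞 ≃ₗ[O]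
  fixedSubmodule (torsionBySet O (act.Pts T) 𝔞) E`, + `_coe`), **`serrePtsTorsionTensorEquiv`** (`≃ₗ[O] torsionBySet O (act.Pts T) 𝔞 ⊗[O] range E`).

## References
* [Conrad2004GrossZagier] B. Conrad, *Gross–Zagier revisited*, MSRI Publ. 49 (2004), §7 (Thm. 7.5: exactness of `M ⊗_A (·)`).
* [MilneCM2006] J. S. Milne, *Complex Multiplication* (2006), §7 (Def. 7.19–Rem. 7.23, pp. 58–59).
* Tree: ★ `SerreTensorPoints`, ★ `SerreTensorIsogeny` (`RingAction.i_natCast`), ★ `Algebra/Module/IdempotentMatrixFixedTensor`.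
-/

noncomputable section

universe u

open CategoryTheory CategoryTheory.Limits AlgebraicGeometry MonoidalCategory CartesianMonoidalCategory
open scoped MonObj TensorProduct

namespace Literature.AlgebraicGeometry.AbelianSchemes

namespace AbelianSchemeOver

open Literature.Algebra.Module.IdempotentMatrix RingAction

variable {S : Scheme.{u}} {A : AbelianSchemeOver S} {O : Type*} [CommRing O] (act : A.RingAction O) [IsCommMonObj A.X]
  {n : ℕ} (E : Matrix (Fin n) (Fin n) O) (hE : E * E = E)

/-! ## §1 Torsion of a point of `A ⊗_𝒪 𝔟` is read on coordinates -/

section Coords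

/-- The coordinates of `t ≫ ι_{A⊗𝔟}(a)` are `t_k ≫ ι(a)`. [cite: Conrad2004GrossZagier, §7 (Thm. 7.5)] -/
theorem serreHomEquiv_comp_serreAction_i {T : Over S} (t : T ⟶ (serreTensor act E hE).X) (a : O) (k : Fin n) :
    (serreHomEquiv act E hE T (t ≫ (serreAction act E hE).i a) : Fin n → (T ⟶ A.X)) k =
      (serreHomEquiv act E hE T t : Fin n → (T ⟶ A.X)) k ≫ act.i a := by
  simp only [serreHomEquiv_apply_coe, Category.assoc, serreAction_i_comp_ι_assoc, matrixEnd_scalar_powProj]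

/-- **`ι_{A⊗𝔟}(a)` kills `t` iff `ι(a)` kills every coordinate `t_k`.** [cite: Conrad2004GrossZagier, §7 (Thm. 7.5)] [cite: MilneCM2006, §7 (Def. 7.19, Prop. 7.22, Rem. 7.23, pp. 58–59)] -/
theorem comp_serreAction_i_eq_one_iff {T : Over S} (t : T ⟶ (serreTensor act E hE).X) (a : O) :
    t ≫ (serreAction act E hE).i a = 1 ↔ ∀ k, (serreHomEquiv act E hE T t : Fin n → (T ⟶ A.X)) k ≫ act.i a = 1 := by
  rw [eq_one_iff_serreHomEquiv]
  simp only [serreHomEquiv_comp_serreAction_i]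

/-- **`(A ⊗ 𝔟)[𝔞](T)` on points**: `t` is killed by `ι(𝔞)` iff every coordinate is. [cite: MilneCM2006, §7 (Def. 7.19, Prop. 7.22, Rem. 7.23, pp. 58–59)] -/
theorem forall_comp_serreAction_i_eq_one_iff {T : Over S} (t : T ⟶ (serreTensor act E hE).X) (𝔞 : Set O) :
    (∀ a ∈ 𝔞, t ≫ (serreAction act E hE).i a = 1) ↔ ∀ k, ∀ a ∈ 𝔞, (serreHomEquiv act E hE T t : Fin n → (T ⟶ A.X)) k ≫ act.i a = 1 := by
  simp only [comp_serreAction_i_eq_one_iff]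
  exact ⟨fun h k a ha => h a ha k, fun h a ha k => h k a ha⟩

/-- **`(A ⊗ 𝔟)[N](T)` on points**: `t^N = 1 ↔ ∀ k, t_k^N = 1`. [cite: Conrad2004GrossZagier, §7 (Thm. 7.5)] -/
theorem pow_eq_one_iff_coords {T : Over S} (t : T ⟶ (serreTensor act E hE).X) (N : ℕ) :
    t ^ N = 1 ↔ ∀ k, ((serreHomEquiv act E hE T t : Fin n → (T ⟶ A.X)) k) ^ N = 1 := by
  have h := comp_serreAction_i_eq_one_iff act E hE t (N : O)
  simp only [RingAction.i_natCast, MonObj.comp_pow, Category.comp_id] at h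
  exact h

end Coords

/-! ## §2 The `𝔞`-torsion submodule: `(A ⊗_𝒪 𝔟)(T)[𝔞] ≃ₗ[𝒪] Fix_E(A(T)[𝔞]ⁿ) ≃ₗ[𝒪] A(T)[𝔞] ⊗_𝒪 𝔟` -/

section Torsion

variable (T : Over S) (𝔞 : Set O) [IsCommMonObj (serreTensor act E hE).X]

/-- Membership in the `𝔞`-torsion of `(A ⊗ 𝔟)(T)` is read on the coordinates in `A(T)`. [cite: MilneCM2006, §7 (Def. 7.19, Prop. 7.22, Rem. 7.23, pp. 58–59)] -/
theorem mem_torsionBySet_iff_coords (x : (serreAction act E hE).Pts T) :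
    x ∈ Submodule.torsionBySet O ((serreAction act E hE).Pts T) 𝔞 ↔
      ∀ k, (serrePtsEquiv act E hE T x : Fin n → act.Pts T) k ∈ Submodule.torsionBySet O (act.Pts T) 𝔞 := by
  simp only [Submodule.mem_torsionBySet_iff]
  constructor
  · intro h k a
    have ha := congrArg (fun y => ((serrePtsEquiv act E hE T y : Fin n → act.Pts T) k)) (h a)
    simp only [map_smul, map_zero] at ha
    exact ha
  · intro h a
    apply (serrePtsEquiv act E hE T).injective
    rw [map_smul, map_zero]
    apply Subtype.ext
    funext k
    exact h k a

/-- **`(A ⊗_𝒪 𝔟)(T)[𝔞] ≃ₗ[𝒪] Fix_E(A(T)[𝔞]ⁿ)`**: ★ `serrePtsEquiv` restricted to the `𝔞`-torsion.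
[cite: Conrad2004GrossZagier, §7 (Thm. 7.5)] [cite: MilneCM2006, §7 (Def. 7.19, Prop. 7.22, Rem. 7.23, pp. 58–59)] -/
def serrePtsTorsionEquiv :
    Submodule.torsionBySet O ((serreAction act E hE).Pts T) 𝔞 ≃ₗ[O]
      fixedSubmodule (Submodule.torsionBySet O (act.Pts T) 𝔞) E where
  toFun x := ⟨fun k => ⟨(serrePtsEquiv act E hE T x.1 : Fin n → act.Pts T) k, (mem_torsionBySet_iff_coords act E hE T 𝔞 x.1).1 x.2 k⟩, by
    rw [mem_fixedSubmodule_iff]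
    funext j
    apply Subtype.ext
    rw [coe_smulVecLin_subtype]
    exact congrFun ((mem_fixedSubmodule_iff _ E _).1 (serrePtsEquiv act E hE T x.1).2) j⟩
  invFun v := ⟨(serrePtsEquiv act E hE T).symm ⟨fun k => ((v : Fin n → Submodule.torsionBySet O (act.Pts T) 𝔞) k : act.Pts T), by
      rw [mem_fixedSubmodule_iff]
      funext j
      have h := congrFun ((mem_fixedSubmodule_iff _ E _).1 v.2) j
      rw [← coe_smulVecLin_subtype, h]⟩,
    (mem_torsionBySet_iff_coords act E hE T 𝔞 _).2 fun k => by
      rw [LinearEquiv.apply_symm_apply]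
      exact ((v : Fin n → Submodule.torsionBySet O (act.Pts T) 𝔞) k).2⟩
  map_add' x y := by
    apply Subtype.ext; funext k; apply Subtype.ext
    change (serrePtsEquiv act E hE T (x.1 + y.1) : Fin n → act.Pts T) k = _
    rw [map_add]
    rfl
  map_smul' c x := by
    apply Subtype.ext; funext k; apply Subtype.ext
    change (serrePtsEquiv act E hE T (c • x.1) : Fin n → act.Pts T) k = _
    rw [map_smul]
    rfl
  left_inv x := by
    apply Subtype.ext
    change (serrePtsEquiv act E hE T).symm _ = x.1
    rw [LinearEquiv.symm_apply_eq]
  right_inv v := by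
    apply Subtype.ext; funext k; apply Subtype.ext
    change (serrePtsEquiv act E hE T ((serrePtsEquiv act E hE T).symm _) : Fin n → act.Pts T) k = _
    rw [LinearEquiv.apply_symm_apply]

/-- Coordinates of `serrePtsTorsionEquiv x` are those of ★ `serrePtsEquiv`. [cite: Conrad2004GrossZagier, §7 (Thm. 7.5)] -/
theorem serrePtsTorsionEquiv_coe (x : Submodule.torsionBySet O ((serreAction act E hE).Pts T) 𝔞) (k : Fin n) :
    (((serrePtsTorsionEquiv act E hE T 𝔞 x : Fin n → Submodule.torsionBySet O (act.Pts T) 𝔞) k : act.Pts T)) =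
      (serrePtsEquiv act E hE T x.1 : Fin n → act.Pts T) k := rfl

/-- **`(A ⊗_𝒪 𝔟)(T)[𝔞] ≃ₗ[𝒪] A(T)[𝔞] ⊗_𝒪 𝔟`** (`𝔟 = E·𝒪ⁿ`): torsion commutes with the Serre tensor on points, for EVERY set of scalars `𝔞`
(`𝔞 = {N}`: `(A ⊗ 𝔟)[N](T) = A[N](T) ⊗ 𝔟`; `𝔞 = 𝔴`: the `𝔴`-blocks). [cite: Conrad2004GrossZagier, §7 (Thm. 7.5)] [cite: MilneCM2006, §7 (Def. 7.19, Prop. 7.22, Rem. 7.23, pp. 58–59)] -/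
def serrePtsTorsionTensorEquiv :
    Submodule.torsionBySet O ((serreAction act E hE).Pts T) 𝔞 ≃ₗ[O]
      Submodule.torsionBySet O (act.Pts T) 𝔞 ⊗[O] LinearMap.range (Matrix.toLin' E) :=
  (serrePtsTorsionEquiv act E hE T 𝔞).trans (tensorRangeEquivFixed (Submodule.torsionBySet O (act.Pts T) 𝔞) E hE).symm

/-- On pure tensors the inverse sends `x ⊗ v` (`x ∈ A(T)[𝔞]`, `v ∈ E·𝒪ⁿ`) to the torsion point with coordinates `(v_k • x)_k`.
[cite: Conrad2004GrossZagier, §7 (Thm. 7.5)] -/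
theorem serrePtsTorsionTensorEquiv_symm_tmul_coe (x : Submodule.torsionBySet O (act.Pts T) 𝔞) (v : LinearMap.range (Matrix.toLin' E)) (k : Fin n) :
    (((serrePtsTorsionEquiv act E hE T 𝔞 ((serrePtsTorsionTensorEquiv act E hE T 𝔞).symm (x ⊗ₜ v)) :
      Fin n → Submodule.torsionBySet O (act.Pts T) 𝔞) k : act.Pts T)) = (v : Fin n → O) k • (x : act.Pts T) := by
  change (((serrePtsTorsionEquiv act E hE T 𝔞 ((serrePtsTorsionEquiv act E hE T 𝔞).symm
    (tensorRangeEquivFixed _ E hE (x ⊗ₜ v))) : Fin n → Submodule.torsionBySet O (act.Pts T) 𝔞) k : act.Pts T)) = _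
  rw [LinearEquiv.apply_symm_apply, tensorRangeEquivFixed_tmul_coe, Submodule.coe_smul]

end Torsion

end AbelianSchemeOver

end Literature.AlgebraicGeometry.AbelianSchemes

end
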